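import Mathlib
import HarnessLib
import Summits.HubbardSuperconductivity.HubbardSuperconductivity.Theorems.KLProgrammeKLRegimeWickScaleFlowC1
import Summits.HubbardSuperconductivity.HubbardSuperconductivity.Theorems.KLProgrammeKLRegimeWickScaleFlowRungs
import Summits.HubbardSuperconductivity.HubbardSuperconductivity.Theorems.KLProgrammeKLRegimeSplitEdgeFactsRunningWeight
import Summits.HubbardSuperconductivity.HubbardSuperconductivity.Theorems.KLProgrammeKLRegimeEngineV8PairTransferRelDefs

/-!
# Route `KLProgramme` — ENGINE child gen 8 (stmt-HubbardSuperconductivity-20437 `KLRegimeEngineV17F2`), skeleton v2 class #5 «(S)-transfer» rev 3 (RELATIVE family,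
# INDEX form): the MEMBER FLOW along a slice, BY NAME — the curves `Aᵢ, Ȧᵢ, bᵢ, ḃᵢ, a` of `pairTransferRelAt_succ` as model objects
# (cell gate-hubbard-kl, seat hubbard-kl-k3c1-p1 g11, technique «composed-map remainder propagation»; KLTC-INDEX-v7 §B.1–2)

WHY.  The class-#5 producer door `pairTransferRelAt_succ` (p586440) reads, per pair `(ψ₁ | ψ₂)` and pair class `Qm`, two Riccati flows `Ȧᵢ = −Aᵢ·diag ḃᵢ·Aᵢ + Sᵢ` on
`[0,1]` with `Aᵢ(1) = klMemberArrayF … (n+1) ψᵢ Qm`, the relative weight `a` with `ȧ = ḃ₁ − ḃ₂` and `a(1) = −(t_{n+1}[ψ₁] − t_{n+1}[ψ₂])`, and the start relation on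
`Aᵢ(0)`.  This file CONSTRUCTS these curves from the model and proves every calculus conjunct of the bundle, so that the (c) closer is left with SIZES only
(a priori `m`, rates `β′`, profiles `ρᵢ`, source majorants `ξᵢ, ξ, I`, the (F)(i) frame majorants, the budget line):
* §1 the MEMBER CARRIER at real cutoff `Λ` and frame `K`: `𝓜^{K,ψ}_Λ := e^{Δ_{S_ψ + C^K_{>Λ₁} − C^K_{>Λ}}}·𝒢^K_Λ` — Wick ordering w.r.t. the member's own soft covariance
  `S_ψ = softCovOf K ψ` PLUS the not-yet-integrated part of the slice; `klmf_carrierCov_eq` identifies that covariance with `softCovOf K φ_Λ`, `φ_Λ = ψ + (w^K_{Λ₁} − w^K_Λ)`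
  (p1's running symbol, `…SplitEdgeFactsRunningWeight`); its kernels obey the BILINEAR Wick flow `∂_Λ 𝒱_m(𝓜_Λ) = −½·𝒱_m(e^{Δ}(δ𝒢_Λ/δψ, Ċ_Λ δ𝒢_Λ/δψ))`
  (`klmf_hasDerivAt_vertexFn_member`, the generic `klws_hasDerivAt_kernel_wickCarrier` at the member's total covariance) with a continuous right-hand side
  (`klmf_continuousAt_vertexFn_memberSource`);
* §2 the MEMBER PAIR ARRAY along slice `n+1` (affine path `Λ(t) = Λ_n + t(Λ_{n+1} − Λ_n)`, ball-truncated, frequencies pinned at `ω₀`): `klmf_memberArray_flowData` — entrywise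
  `HasDerivAt` on `[0,1]`, continuous derivative, `A(1) =` the ball array of `klCovSmearedPairAmplitude … K (n+1) (softCovOf K ψ)` (at `K := K_{n+1}` literally
  `klMemberArrayF … (n+1) ψ Qm`, `klmf_memberArray_one_eq_klMemberArrayF`) and `A(0) =` the ball array of `klCovSmearedPairAmplitude … K n (softCovOf K (ψ + s^K_{n,n+1}))`
  — the HISTORY member read at the new frame (the (F)(i) lane compares it with `klMemberArrayF … n (s^{K_n}_{n,m}) Qm`);
* §3 the RUNGS: `b(t) = B(φ_{Λ(t)}, φ_{Λ(t)})` (complexified `klBubbleMass`), `ḃ` by p1's `hasDerivAt_runningSmearedWeight` along the affine path, the relative weight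
  `a = b₁ − b₂ + const` with `ȧ = ḃ₁ − ḃ₂`, `a(1) = −(t_{n+1}[ψ₁] − t_{n+1}[ψ₂])` and — by `klTransferWeight_sub_succ` + `runningSmearedWeight_upper_sub_lower` —
  `a(0) = −(t^K_n[ψ₁ + s] − t^K_n[ψ₂ + s])` at the SAME frame `K` (`klmf_relWeight_data`);
* §4 the RICCATI DEFECT as the source: with `S := Ȧ + A·diag ḃ·A` the flow equation `Ȧ = −A·diag ḃ·A + S` holds by algebra and `S` is continuous (`klmf_riccati_of_defect`) —
  the door's `hflowᵢ`, `hSᵢc`; what `S` COSTS (`ξᵢ`, and the relative source's `ξ, I`) is the analytic lanes' (§B.3 of KLTC-INDEX-v7).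
Exact calculus over landed lemmas; nothing about the model's sizes is asserted; nothing asserts superconductivity.  0 kit.
-/

noncomputable section

namespace Summit.HubbardSuperconductivity.HubbardSuperconductivity.Theorems.KLRegimeSplit

set_option linter.dupNamespace false -- summit = problem name (single-conjunct summit), D-0017

open Finset Matrix Set Literature.MathematicalPhysics.QuantumLattice Literature.Probability.LatticeModels GrassmannAlgebra
open Summit.HubbardSuperconductivity.HubbardSuperconductivity.Theorems.KLProgrammeLegKernels
open Summit.HubbardSuperconductivity.HubbardSuperconductivity.Theorems.DispersionFlow
open Summit.HubbardSuperconductivity.HubbardSuperconductivity.Theorems.KLRegimeWick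
open scoped Topology

/-! ## §1 The member carrier at real cutoff: covariance identity and the bilinear Wick flow of its kernels -/

section Carrier

variable (L M : ℕ) [NeZero L] (β U μ : ℝ) (K : TrigPolyC4v)

/-- **The member carrier's Wick covariance is the running symbol's covariance**: `softCovOf K ψ + C^K_{>Λ₁} − C^K_{>Λ} = softCovOf K (ψ + (w^K_{Λ₁} − w^K_Λ))`. -/
theorem klmf_carrierCov_eq (ψ : FreqMomentum L M → ℝ) (Λ₁ Λ : ℝ) :
    softCovOf L M β μ K ψ + hubbardCovAboveCT L M β μ 0 K Λ₁ - hubbardCovAboveCT L M β μ 0 K Λ =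
      softCovOf L M β μ K (fun k => ψ k + (hubbardCutoffWeightCT L M β μ K Λ₁ k - hubbardCutoffWeightCT L M β μ K Λ k)) := by
  rw [add_sub_assoc, ← hubbardCovSliceCT, hubbardCovSliceCT_zero_seed, softCovOf, softCovOf, ← normalCovariance_add_symbol]
  congr 1
  funext ks
  push_cast
  ring

/-- On the scale grid: `softCovOf K ψ + C^K_{>Λ_{n+1}} − C^K_{>Λ_n} = softCovOf K (ψ + s^K_{n,n+1})` (the HISTORY member's covariance). -/
theorem klmf_carrierCov_klScale (ψ : FreqMomentum L M → ℝ) (n : ℕ) :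
    softCovOf L M β μ K ψ + hubbardCovAboveCT L M β μ 0 K (klScale klE0 (n + 1)) - hubbardCovAboveCT L M β μ 0 K (klScale klE0 n) =
      softCovOf L M β μ K (ψ + softSymbolCompl L M β μ K n (n + 1)) := by
  rw [klmf_carrierCov_eq]
  congr 1

/-- **The bilinear Wick flow of the member carrier's kernels** at real cutoff `Λ ≠ 0` with `Z^K_Λ ≠ 0` (`0 < m`):
`∂_Λ kernel_m(e^{Δ_{S_ψ + C_{>Λ₁} − C_{>Λ}}}𝒢^K_Λ)(X) = −½·kernel_m(e^{Δ_{S_ψ + C_{>Λ₁} − C_{>Λ}}}(δ𝒢_Λ/δψ, Ċ_Λ δ𝒢_Λ/δψ))(X)`. -/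
theorem klmf_hasDerivAt_kernel_member (ψ : FreqMomentum L M → ℝ) (Λ₁ : ℝ) {Λ : ℝ} (hΛ : Λ ≠ 0)
    (hZ : hubbardEffPartitionFnCT L M β U μ 0 K Λ ≠ 0) {m : ℕ} (hm : 0 < m) (X : Fin m → HubbardFieldIdx L M) :
    HasDerivAt (fun Λ' : ℝ => kernel ℂ (gaussConv ℂ
        (softCovOf L M β μ K ψ + hubbardCovAboveCT L M β μ 0 K Λ₁ - hubbardCovAboveCT L M β μ 0 K Λ')
        (hubbardEffectiveActionCT L M β U μ 0 K Λ')) m X)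
      (-((2 : ℂ)⁻¹ * kernel ℂ (gaussConv ℂ
        (softCovOf L M β μ K ψ + hubbardCovAboveCT L M β μ 0 K Λ₁ - hubbardCovAboveCT L M β μ 0 K Λ)
        (grassmannDerivPairing ℂ
          (Matrix.of fun X Y : HubbardFieldIdx L M => deriv (fun Λ'' : ℝ => hubbardCovAboveCT L M β μ 0 K Λ'' X Y) Λ)
          (hubbardEffectiveActionCT L M β U μ 0 K Λ) (hubbardEffectiveActionCT L M β U μ 0 K Λ))) m X)) Λ := by
  letI : LinearOrder (HubbardFieldIdx L M) := LinearOrder.lift' (Fintype.equivFin _) (Fintype.equivFin _).injective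
  exact klws_hasDerivAt_kernel_wickCarrier (𝕂 := ℝ) (softCovOf L M β μ K ψ + hubbardCovAboveCT L M β μ 0 K Λ₁)
    (klws_hasDerivAt_hardCov_scale L M β μ K hΛ) (constPart_hubbardInteractionCT L M β U K)
    (AposterioriCapRgSeededBrokenRegimeBoseFermiPinned.hubbardInteractionCT_mem_evenOdd_zero L M β U K) hZ hm X

/-- Continuity in the cutoff of that right-hand side's kernels (`Λ ≠ 0`, `Z^K_Λ ≠ 0`). -/
theorem klmf_continuousAt_kernel_memberSource (ψ : FreqMomentum L M → ℝ) (Λ₁ : ℝ) {Λ : ℝ} (hΛ : Λ ≠ 0)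
    (hZ : hubbardEffPartitionFnCT L M β U μ 0 K Λ ≠ 0) (m : ℕ) (X : Fin m → HubbardFieldIdx L M) :
    ContinuousAt (fun Λ' : ℝ => kernel ℂ (gaussConv ℂ
        (softCovOf L M β μ K ψ + hubbardCovAboveCT L M β μ 0 K Λ₁ - hubbardCovAboveCT L M β μ 0 K Λ')
        (grassmannDerivPairing ℂ
          (Matrix.of fun X Y : HubbardFieldIdx L M => deriv (fun Λ'' : ℝ => hubbardCovAboveCT L M β μ 0 K Λ'' X Y) Λ')
          (hubbardEffectiveActionCT L M β U μ 0 K Λ') (hubbardEffectiveActionCT L M β U μ 0 K Λ'))) m X) Λ := by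
  letI : LinearOrder (HubbardFieldIdx L M) := LinearOrder.lift' (Fintype.equivFin _) (Fintype.equivFin _).injective
  exact klws_continuousAt_kernel_wickSource (𝕂 := ℝ) (softCovOf L M β μ K ψ + hubbardCovAboveCT L M β μ 0 K Λ₁)
    (klws_hasDerivAt_hardCov_scale L M β μ K hΛ) (constPart_hubbardInteractionCT L M β U K)
    (AposterioriCapRgSeededBrokenRegimeBoseFermiPinned.hubbardInteractionCT_mem_evenOdd_zero L M β U K) hZ
    (B := fun Λ' => Matrix.of fun X Y : HubbardFieldIdx L M => deriv (fun Λ'' : ℝ => hubbardCovAboveCT L M β μ 0 K Λ'' X Y) Λ')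
    (fun X Y => by simpa only [Matrix.of_apply] using klws_hasDerivAt_derivHardCov_scale L M β μ K hΛ X Y) m X

/-- **The bilinear Wick flow of the member carrier's vertex functions** at real cutoff `Λ ≠ 0` with `Z^K_Λ ≠ 0`: for `0 < m`,
`∂_Λ 𝒱_m(e^{Δ_{S_ψ + C_{>Λ₁} − C_{>Λ}}}𝒢^K_Λ)(X) = −½·𝒱_m(e^{Δ_{S_ψ + C_{>Λ₁} − C_{>Λ}}}(δ𝒢_Λ/δψ, Ċ_Λ δ𝒢_Λ/δψ))(X)`. -/
theorem klmf_hasDerivAt_vertexFn_member (ψ : FreqMomentum L M → ℝ) (Λ₁ : ℝ) {Λ : ℝ} (hΛ : Λ ≠ 0)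
    (hZ : hubbardEffPartitionFnCT L M β U μ 0 K Λ ≠ 0) {m : ℕ} (hm : 0 < m) (X : Fin m → HubbardFieldIdx L M) :
    HasDerivAt (fun Λ' : ℝ => vertexFn L M β (gaussConv ℂ
        (softCovOf L M β μ K ψ + hubbardCovAboveCT L M β μ 0 K Λ₁ - hubbardCovAboveCT L M β μ 0 K Λ')
        (hubbardEffectiveActionCT L M β U μ 0 K Λ')) m X)
      (-((2 : ℂ)⁻¹ * vertexFn L M β (gaussConv ℂ
        (softCovOf L M β μ K ψ + hubbardCovAboveCT L M β μ 0 K Λ₁ - hubbardCovAboveCT L M β μ 0 K Λ)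
        (grassmannDerivPairing ℂ
          (Matrix.of fun X Y : HubbardFieldIdx L M => deriv (fun Λ'' : ℝ => hubbardCovAboveCT L M β μ 0 K Λ'' X Y) Λ)
          (hubbardEffectiveActionCT L M β U μ 0 K Λ) (hubbardEffectiveActionCT L M β U μ 0 K Λ))) m X)) Λ := by
  have h := (klmf_hasDerivAt_kernel_member L M β U μ K ψ Λ₁ hΛ hZ hm X).const_mul
    ((((m.factorial : ℝ) * (β * (L : ℝ) ^ 2) ^ (m - 1) : ℝ) : ℂ))
  simp only [vertexFn_def]
  refine h.congr_deriv ?_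
  ring

/-- **Continuity of that right-hand side in the cutoff** (`Λ ≠ 0`, `Z^K_Λ ≠ 0`). -/
theorem klmf_continuousAt_vertexFn_memberSource (ψ : FreqMomentum L M → ℝ) (Λ₁ : ℝ) {Λ : ℝ} (hΛ : Λ ≠ 0)
    (hZ : hubbardEffPartitionFnCT L M β U μ 0 K Λ ≠ 0) (m : ℕ) (X : Fin m → HubbardFieldIdx L M) :
    ContinuousAt (fun Λ' : ℝ => -((2 : ℂ)⁻¹ * vertexFn L M β (gaussConv ℂ
        (softCovOf L M β μ K ψ + hubbardCovAboveCT L M β μ 0 K Λ₁ - hubbardCovAboveCT L M β μ 0 K Λ')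
        (grassmannDerivPairing ℂ
          (Matrix.of fun X Y : HubbardFieldIdx L M => deriv (fun Λ'' : ℝ => hubbardCovAboveCT L M β μ 0 K Λ'' X Y) Λ')
          (hubbardEffectiveActionCT L M β U μ 0 K Λ') (hubbardEffectiveActionCT L M β U μ 0 K Λ'))) m X)) Λ := by
  have h := (klmf_continuousAt_kernel_memberSource L M β U μ K ψ Λ₁ hΛ hZ m X).const_mul
    ((((m.factorial : ℝ) * (β * (L : ℝ) ^ 2) ^ (m - 1) : ℝ) : ℂ))
  simp only [vertexFn_def]
  exact (h.const_mul (2 : ℂ)⁻¹).neg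

/-- **Grid endpoints of the member carrier**: at `Λ = Λ_{n+1}` (with `Λ₁ = Λ_{n+1}`) it is `e^{Δ_{S_ψ}}𝒱_{n+1}[K]` … -/
theorem klmf_carrier_at_lower (ψ : FreqMomentum L M → ℝ) (n : ℕ) :
    gaussConv ℂ (softCovOf L M β μ K ψ + hubbardCovAboveCT L M β μ 0 K (klScale klE0 (n + 1)) -
        hubbardCovAboveCT L M β μ 0 K (klScale klE0 (n + 1))) (hubbardEffectiveActionCT L M β U μ 0 K (klScale klE0 (n + 1))) =
      gaussConv ℂ (softCovOf L M β μ K ψ) (klEffectiveAction L M β U μ K klE0 (n + 1)) := by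
  rw [add_sub_cancel_right]; rfl

/-- … and at `Λ = Λ_n` it is `e^{Δ_{S_{ψ + s_{n,n+1}}}}𝒱_n[K]` (the history member of `𝒱_n`, same frame). -/
theorem klmf_carrier_at_upper (ψ : FreqMomentum L M → ℝ) (n : ℕ) :
    gaussConv ℂ (softCovOf L M β μ K ψ + hubbardCovAboveCT L M β μ 0 K (klScale klE0 (n + 1)) -
        hubbardCovAboveCT L M β μ 0 K (klScale klE0 n)) (hubbardEffectiveActionCT L M β U μ 0 K (klScale klE0 n)) =
      gaussConv ℂ (softCovOf L M β μ K (ψ + softSymbolCompl L M β μ K n (n + 1))) (klEffectiveAction L M β U μ K klE0 n) := by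
  rw [klmf_carrierCov_klScale]; rfl

end Carrier

/-! ## §2 The member pair array along slice `n+1` (ball-truncated, frequencies pinned at `ω₀`) -/

section Array

variable (L M : ℕ) [NeZero L] [NeZero M] (β U μ : ℝ) (K : TrigPolyC4v)

/-- Positivity and ordering of the slice endpoints: `0 < Λ_{n+1} ≤ Λ_n`. -/
theorem klmf_klScale_succ_pos_le (n : ℕ) : 0 < klScale klE0 (n + 1) ∧ klScale klE0 (n + 1) ≤ klScale klE0 n := by
  simpa using klws_klScale_pos_antitone (n + 1)

/-- Along the affine path of slice `n+1` the cutoff is non-zero. -/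
theorem klmf_affine_ne_zero (n : ℕ) {t : ℝ} (ht : t ∈ Icc (0 : ℝ) 1) :
    klScale klE0 n + t * (klScale klE0 (n + 1) - klScale klE0 n) ≠ 0 :=
  ((klmf_klScale_succ_pos_le n).1.trans_le (klws_affine_mem_Icc (klmf_klScale_succ_pos_le n).2 ht).1).ne'

set_option maxHeartbeats 400000 in -- four long label tuples; entrywise case split
/-- **Flow data of the member pair array along slice `n+1`** (frame `K`, member `ψ`, pair class `Qm`; `Z^K ≠ 0` on the slice).  With `Λ(t) = Λ_n + t(Λ_{n+1} − Λ_n)`,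
`A t` = the ball-truncated pair array of the member carrier `e^{Δ_{S_ψ + C_{>Λ_{n+1}} − C_{>Λ(t)}}}𝒢^K_{Λ(t)}` at the `ω₀`-pinned pair labels of `klCovSmearedPairAmplitude`, and `Ȧ t`
its bilinear-flow derivative (both given by equations — pass `rfl, rfl`): entrywise `HasDerivAt` on `[0,1]`, entrywise continuity of `Ȧ` on `[0,1]`, and the ENDPOINTS
`A 1 =` ball array of `klCovSmearedPairAmplitude … K (n+1) (softCovOf K ψ)`, `A 0 =` ball array of `klCovSmearedPairAmplitude … K n (softCovOf K (ψ + s^K_{n,n+1}))`. -/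
theorem klmf_memberArray_flowData (n : ℕ) (ψ : FreqMomentum L M → ℝ) (Qm : TorusSite 2 L)
    (hZ : ∀ Λ ∈ Icc (klScale klE0 (n + 1)) (klScale klE0 n), hubbardEffPartitionFnCT L M β U μ 0 K Λ ≠ 0)
    (A A' : ℝ → Matrix (TorusSite 2 L) (TorusSite 2 L) ℂ)
    (hAdef : A = fun t => Matrix.of fun k k' : TorusSite 2 L => if k ∈ klBall L μ 0 ∧ k' ∈ klBall L μ 0 then
      vertexFn L M β (gaussConv ℂ
        (softCovOf L M β μ K ψ + hubbardCovAboveCT L M β μ 0 K (klScale klE0 (n + 1)) -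
          hubbardCovAboveCT L M β μ 0 K (klScale klE0 n + t * (klScale klE0 (n + 1) - klScale klE0 n)))
        (hubbardEffectiveActionCT L M β U μ 0 K (klScale klE0 n + t * (klScale klE0 (n + 1) - klScale klE0 n)))) 4
        ![(((omega0 M, k'), 0), 0), ((((omega0 M).rev, Qm - k'), 1), 0), ((((omega0 M).rev, Qm - k), 1), 1), (((omega0 M, k), 0), 1)]
      else 0)
    (hA'def : A' = fun t => Matrix.of fun k k' : TorusSite 2 L => if k ∈ klBall L μ 0 ∧ k' ∈ klBall L μ 0 then
      (klScale klE0 (n + 1) - klScale klE0 n) • -((2 : ℂ)⁻¹ * vertexFn L M β (gaussConv ℂ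
        (softCovOf L M β μ K ψ + hubbardCovAboveCT L M β μ 0 K (klScale klE0 (n + 1)) -
          hubbardCovAboveCT L M β μ 0 K (klScale klE0 n + t * (klScale klE0 (n + 1) - klScale klE0 n)))
        (grassmannDerivPairing ℂ
          (Matrix.of fun X Y : HubbardFieldIdx L M => deriv (fun Λ'' : ℝ => hubbardCovAboveCT L M β μ 0 K Λ'' X Y)
            (klScale klE0 n + t * (klScale klE0 (n + 1) - klScale klE0 n)))
          (hubbardEffectiveActionCT L M β U μ 0 K (klScale klE0 n + t * (klScale klE0 (n + 1) - klScale klE0 n)))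
          (hubbardEffectiveActionCT L M β U μ 0 K (klScale klE0 n + t * (klScale klE0 (n + 1) - klScale klE0 n))))) 4
        ![(((omega0 M, k'), 0), 0), ((((omega0 M).rev, Qm - k'), 1), 0), ((((omega0 M).rev, Qm - k), 1), 1), (((omega0 M, k), 0), 1)])
      else 0) :
    (∀ t ∈ Icc (0 : ℝ) 1, ∀ x y, HasDerivAt (fun s => A s x y) (A' t x y) t) ∧
    (∀ x y, ContinuousOn (fun t => A' t x y) (Icc 0 1)) ∧
    (A 1 = Matrix.of fun k k' : TorusSite 2 L => if k ∈ klBall L μ 0 ∧ k' ∈ klBall L μ 0 then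
      klCovSmearedPairAmplitude L M β U μ K (n + 1) (softCovOf L M β μ K ψ) Qm k k' else 0) ∧
    (A 0 = Matrix.of fun k k' : TorusSite 2 L => if k ∈ klBall L μ 0 ∧ k' ∈ klBall L μ 0 then
      klCovSmearedPairAmplitude L M β U μ K n (softCovOf L M β μ K (ψ + softSymbolCompl L M β μ K n (n + 1))) Qm k k' else 0) := by
  have h10 := (klmf_klScale_succ_pos_le n).2
  have hne : ∀ t ∈ Icc (0 : ℝ) 1, klScale klE0 n + t * (klScale klE0 (n + 1) - klScale klE0 n) ≠ 0 := fun t ht =>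
    klmf_affine_ne_zero n ht
  have hZt : ∀ t ∈ Icc (0 : ℝ) 1,
      hubbardEffPartitionFnCT L M β U μ 0 K (klScale klE0 n + t * (klScale klE0 (n + 1) - klScale klE0 n)) ≠ 0 := fun t ht =>
    hZ _ (klws_affine_mem_Icc h10 ht)
  subst hAdef hA'def
  refine ⟨fun t ht x y => ?_, fun x y => ?_, ?_, ?_⟩
  · by_cases hxy : x ∈ klBall L μ 0 ∧ y ∈ klBall L μ 0
    · have hg := klmf_hasDerivAt_vertexFn_member L M β U μ K ψ (klScale klE0 (n + 1)) (hne t ht) (hZt t ht) (by norm_num : 0 < 4)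
        ![(((omega0 M, y), 0), 0), ((((omega0 M).rev, Qm - y), 1), 0), ((((omega0 M).rev, Qm - x), 1), 1), (((omega0 M, x), 0), 1)]
      have h := hg.scomp t (klws_hasDerivAt_affine (klScale klE0 n) (klScale klE0 (n + 1)) t)
      simpa only [Matrix.of_apply, if_pos hxy, Function.comp_def] using h
    · simpa only [Matrix.of_apply, if_neg hxy] using hasDerivAt_const t (0 : ℂ)
  · by_cases hxy : x ∈ klBall L μ 0 ∧ y ∈ klBall L μ 0
    · intro t ht
      have hc := klmf_continuousAt_vertexFn_memberSource L M β U μ K ψ (klScale klE0 (n + 1)) (hne t ht) (hZt t ht) 4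
        ![(((omega0 M, y), 0), 0), ((((omega0 M).rev, Qm - y), 1), 0), ((((omega0 M).rev, Qm - x), 1), 1), (((omega0 M, x), 0), 1)]
      have h := (ContinuousAt.comp (f := fun s : ℝ => klScale klE0 n + s * (klScale klE0 (n + 1) - klScale klE0 n)) (x := t) hc
        (klws_hasDerivAt_affine (klScale klE0 n) (klScale klE0 (n + 1)) t).continuousAt).const_smul
        (klScale klE0 (n + 1) - klScale klE0 n)
      simpa only [Matrix.of_apply, if_pos hxy, Function.comp_def, Pi.smul_def] using h.continuousWithinAt
    · simpa only [Matrix.of_apply, if_neg hxy] using continuousOn_const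
  · ext k k'
    simp only [Matrix.of_apply, one_mul, add_sub_cancel]
    split_ifs with hkk
    · rw [klmf_carrier_at_lower]; rfl
    · rfl
  · ext k k'
    simp only [Matrix.of_apply, zero_mul, add_zero]
    split_ifs with hkk
    · rw [klmf_carrier_at_upper]; rfl
    · rfl

/-- At the flowing frame `K := K_{n+1}` the endpoint `A 1` IS `klMemberArrayF … (n+1) ψ Qm` (`rfl` on the truncation). -/
theorem klmf_ballArray_succ_eq_klMemberArrayF (n : ℕ) (ψ : FreqMomentum L M → ℝ) (Qm : TorusSite 2 L) :
    (Matrix.of fun k k' : TorusSite 2 L => if k ∈ klBall L μ 0 ∧ k' ∈ klBall L μ 0 then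
      klCovSmearedPairAmplitude L M β U μ (klFlowFrameU L M β U μ (n + 1)) (n + 1)
        (softCovOf L M β μ (klFlowFrameU L M β U μ (n + 1)) ψ) Qm k k' else 0) =
      klMemberArrayF L M β U μ (n + 1) ψ Qm := rfl

end Array

/-! ## §3 The rungs: running smeared weights along the affine path, the relative weight and its endpoints -/

section Rungs

variable (L M : ℕ) (β μ : ℝ) (K : TrigPolyC4v)

/-- Continuity in the cutoff of a pair mass `Λ ↦ B(a_Λ, b_Λ)(Qm,p)` whose symbols are continuous in `Λ` pointwise. -/
theorem klmf_continuousAt_klBubbleMass {a b : ℝ → FreqMomentum L M → ℝ} {Λ : ℝ}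
    (ha : ∀ k, ContinuousAt (fun Λ' => a Λ' k) Λ) (hb : ∀ k, ContinuousAt (fun Λ' => b Λ' k) Λ) (Qm p : TorusSite 2 L) :
    ContinuousAt (fun Λ' => klBubbleMass L M β μ K (a Λ') (b Λ') Qm p) Λ := by
  simp only [klBubbleMass_eq_real_sum]
  refine continuousAt_const.mul ?_
  refine tendsto_finsetSum _ fun ν _ => ?_
  exact ((ha (ν, p)).mul (hb (ν.rev, Qm - p))).mul continuousAt_const

/-- **The running smeared weight along the affine path of slice `n+1`** — the door's `bᵢ, ḃᵢ` for the member `ψ` (given by equations, pass `rfl, rfl`):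
`b t p = −B(φ_{Λ(t)}, φ_{Λ(t)})(Qm,p)` (so that `b 1 − b 0 = klSliceWeightSmeared … (n+1) ψ`, the cumulative rung in the `1 + diag` convention) and
`ḃ t p = (Λ_{n+1} − Λ_n)·(B(ẇ_{Λ(t)}, φ_{Λ(t)}) + B(φ_{Λ(t)}, ẇ_{Λ(t)}))(Qm,p)`: `HasDerivAt` on `[0,1]`, continuity of `ḃ` on `[0,1]`, and the endpoint identity. -/
theorem klmf_rung_data (n : ℕ) (ψ : FreqMomentum L M → ℝ) (Qm : TorusSite 2 L) (b b' : ℝ → TorusSite 2 L → ℂ)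
    (hbdef : b = fun t p => -((klBubbleMass L M β μ K
        (fun k => ψ k + (hubbardCutoffWeightCT L M β μ K (klScale klE0 (n + 1)) k -
          hubbardCutoffWeightCT L M β μ K (klScale klE0 n + t * (klScale klE0 (n + 1) - klScale klE0 n)) k))
        (fun k => ψ k + (hubbardCutoffWeightCT L M β μ K (klScale klE0 (n + 1)) k -
          hubbardCutoffWeightCT L M β μ K (klScale klE0 n + t * (klScale klE0 (n + 1) - klScale klE0 n)) k)) Qm p : ℝ) : ℂ))
    (hb'def : b' = fun t p => (((klScale klE0 (n + 1) - klScale klE0 n) *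
        (klBubbleMass L M β μ K
            (fun k => deriv (fun Λ' => hubbardCutoffWeightCT L M β μ K Λ' k) (klScale klE0 n + t * (klScale klE0 (n + 1) - klScale klE0 n)))
            (fun k => ψ k + (hubbardCutoffWeightCT L M β μ K (klScale klE0 (n + 1)) k -
              hubbardCutoffWeightCT L M β μ K (klScale klE0 n + t * (klScale klE0 (n + 1) - klScale klE0 n)) k)) Qm p +
          klBubbleMass L M β μ K
            (fun k => ψ k + (hubbardCutoffWeightCT L M β μ K (klScale klE0 (n + 1)) k -
              hubbardCutoffWeightCT L M β μ K (klScale klE0 n + t * (klScale klE0 (n + 1) - klScale klE0 n)) k))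
            (fun k => deriv (fun Λ' => hubbardCutoffWeightCT L M β μ K Λ' k) (klScale klE0 n + t * (klScale klE0 (n + 1) - klScale klE0 n)))
            Qm p) : ℝ) : ℂ)) :
    (∀ t ∈ Icc (0 : ℝ) 1, ∀ p, HasDerivAt (fun s => b s p) (b' t p) t) ∧
    (∀ p, ContinuousOn (fun t => b' t p) (Icc 0 1)) ∧
    (∀ p, b 1 p - b 0 p = ((klSliceWeightSmeared L M β μ K (n + 1) ψ Qm p : ℝ) : ℂ)) := by
  have hne : ∀ t ∈ Icc (0 : ℝ) 1, klScale klE0 n + t * (klScale klE0 (n + 1) - klScale klE0 n) ≠ 0 := fun t ht =>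
    klmf_affine_ne_zero n ht
  subst hbdef hb'def
  refine ⟨fun t ht p => ?_, fun p t ht => ?_, fun p => ?_⟩
  · have hg := hasDerivAt_runningSmearedWeight β μ K (hne t ht) (klScale klE0 (n + 1)) ψ Qm p
    have h := ((hg.scomp t (klws_hasDerivAt_affine (klScale klE0 n) (klScale klE0 (n + 1)) t)).ofReal_comp).neg
    refine h.congr_deriv ?_
    simp only [smul_eq_mul]
    push_cast
    ring
  · have hφ : ∀ k, ContinuousAt (fun Λ' => ψ k + (hubbardCutoffWeightCT L M β μ K (klScale klE0 (n + 1)) k -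
        hubbardCutoffWeightCT L M β μ K Λ' k)) (klScale klE0 n + t * (klScale klE0 (n + 1) - klScale klE0 n)) := fun k =>
      continuousAt_const.add (continuousAt_const.sub (klws_continuousAt_cutoffWeight_scale L M β μ K (hne t ht) k))
    have hdw : ∀ k, ContinuousAt (fun Λ' => deriv (fun Λ'' => hubbardCutoffWeightCT L M β μ K Λ'' k) Λ')
        (klScale klE0 n + t * (klScale klE0 (n + 1) - klScale klE0 n)) := fun k => klws_continuousAt_derivCutoffWeight_scale L M β μ K (hne t ht) k
    have hB := (continuousAt_const (y := klScale klE0 (n + 1) - klScale klE0 n)).mul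
      ((klmf_continuousAt_klBubbleMass L M β μ K hdw hφ Qm p).add (klmf_continuousAt_klBubbleMass L M β μ K hφ hdw Qm p))
    have h := ContinuousAt.comp (f := fun s : ℝ => klScale klE0 n + s * (klScale klE0 (n + 1) - klScale klE0 n)) (x := t) hB
      (klws_hasDerivAt_affine (klScale klE0 n) (klScale klE0 (n + 1)) t).continuousAt
    have h' := Complex.continuous_ofReal.continuousAt.comp h
    simpa only [Function.comp_def, Pi.mul_apply, Pi.add_apply] using h'.continuousWithinAt
  · dsimp only
    simp only [one_mul, add_sub_cancel, zero_mul, add_zero]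
    rw [← runningSmearedWeight_upper_sub_lower β μ K n ψ Qm p]
    push_cast
    ring

/-- **The relative weight along the slice** — the door's `a`: `a t = (b₁ t − b₂ t) + [a(1) − (b₁ 1 − b₂ 1)]` with `a(1) = −(t_{n+1}[ψ₁] − t_{n+1}[ψ₂])` pinned at frame `K`.
THEN `ȧ = ḃ₁ − ḃ₂` (from the two rung data), `a 1` is the pinned endpoint, and — by `klTransferWeight_sub_succ` and the FTC endpoints — `a 0 = −(t^K_n[ψ₁ + s] − t^K_n[ψ₂ + s])`,
the HISTORY pair's relative weight at the SAME frame `K` (`s = s^K_{n,n+1}`). -/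
theorem klmf_relWeight_data (n : ℕ) (ψ₁ ψ₂ : FreqMomentum L M → ℝ) (Qm : TorusSite 2 L) (b₁ b₂ b₁' b₂' a : ℝ → TorusSite 2 L → ℂ)
    (hb₁ : ∀ t ∈ Icc (0 : ℝ) 1, ∀ p, HasDerivAt (fun s => b₁ s p) (b₁' t p) t)
    (hb₂ : ∀ t ∈ Icc (0 : ℝ) 1, ∀ p, HasDerivAt (fun s => b₂ s p) (b₂' t p) t)
    (hb₁e : ∀ p, b₁ 1 p - b₁ 0 p = ((klSliceWeightSmeared L M β μ K (n + 1) ψ₁ Qm p : ℝ) : ℂ))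
    (hb₂e : ∀ p, b₂ 1 p - b₂ 0 p = ((klSliceWeightSmeared L M β μ K (n + 1) ψ₂ Qm p : ℝ) : ℂ))
    (hadef : a = fun t p => (b₁ t p - b₂ t p) +
      (-(((klTransferWeight L M β μ K (n + 1) ψ₁ Qm p - klTransferWeight L M β μ K (n + 1) ψ₂ Qm p : ℝ)) : ℂ) - (b₁ 1 p - b₂ 1 p))) :
    (∀ t ∈ Icc (0 : ℝ) 1, ∀ p, HasDerivAt (fun s => a s p) (b₁' t p - b₂' t p) t) ∧
    (a 1 = fun p => -(((klTransferWeight L M β μ K (n + 1) ψ₁ Qm p - klTransferWeight L M β μ K (n + 1) ψ₂ Qm p : ℝ)) : ℂ)) ∧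
    (a 0 = fun p => -(((klTransferWeight L M β μ K n (ψ₁ + softSymbolCompl L M β μ K n (n + 1)) Qm p -
        klTransferWeight L M β μ K n (ψ₂ + softSymbolCompl L M β μ K n (n + 1)) Qm p : ℝ)) : ℂ)) := by
  subst hadef
  refine ⟨fun t ht p => ?_, ?_, ?_⟩
  · simpa using ((hb₁ t ht p).sub (hb₂ t ht p)).add_const
      (-(((klTransferWeight L M β μ K (n + 1) ψ₁ Qm p - klTransferWeight L M β μ K (n + 1) ψ₂ Qm p : ℝ)) : ℂ) - (b₁ 1 p - b₂ 1 p))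
  · funext p; dsimp only; ring
  · funext p
    dsimp only
    have e : b₁ 0 p - b₂ 0 p + (-(((klTransferWeight L M β μ K (n + 1) ψ₁ Qm p - klTransferWeight L M β μ K (n + 1) ψ₂ Qm p : ℝ)) : ℂ) -
        (b₁ 1 p - b₂ 1 p)) =
        -((((klTransferWeight L M β μ K (n + 1) ψ₁ Qm p - klTransferWeight L M β μ K (n + 1) ψ₂ Qm p : ℝ)) : ℂ) +
          ((b₁ 1 p - b₁ 0 p) - (b₂ 1 p - b₂ 0 p))) := by ring
    rw [e, hb₁e, hb₂e, klTransferWeight_sub_succ β μ K n ψ₁ ψ₂ Qm p]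
    push_cast
    ring

end Rungs

/-! ## §4 The Riccati defect as the source -/

section Riccati

variable {ι : Type*} [Fintype ι] [DecidableEq ι]

/-- **The flow equation holds with the Riccati defect as source**: `Ȧ = −(A·diag ḃ·A) + S` for `S := Ȧ + A·diag ḃ·A`, and `S` is entrywise continuous on `[0,1]` when
`A` is entrywise differentiable there and `Ȧ`, `ḃ` are entrywise continuous there — the door's `hflowᵢ`/`hSᵢc` (the SIZE of `S` is the analytic lanes'). -/
theorem klmf_riccati_of_defect (A A' S : ℝ → Matrix ι ι ℂ) (b' : ℝ → ι → ℂ)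
    (hA : ∀ t ∈ Icc (0 : ℝ) 1, ∀ x y, HasDerivAt (fun s => A s x y) (A' t x y) t)
    (hA'c : ∀ x y, ContinuousOn (fun t => A' t x y) (Icc 0 1)) (hb'c : ∀ c, ContinuousOn (fun t => b' t c) (Icc 0 1))
    (hSdef : S = fun t => A' t + A t * diagonal (b' t) * A t) :
    (∀ t ∈ Icc (0 : ℝ) 1, A' t = -(A t * diagonal (b' t) * A t) + S t) ∧ (∀ x y, ContinuousOn (fun t => S t x y) (Icc 0 1)) := by
  subst hSdef
  refine ⟨fun t _ => by dsimp only; abel, fun x y => ?_⟩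
  have hAc : ∀ x y, ContinuousOn (fun t => A t x y) (Icc 0 1) := fun x y t ht => (hA t ht x y).continuousAt.continuousWithinAt
  have e : (fun t => (A' t + A t * diagonal (b' t) * A t) x y) = fun t => A' t x y + ∑ c, A t x c * b' t c * A t c y := by
    funext t; rw [Matrix.add_apply, klli_mul_diag_mul_apply]
  rw [e]
  refine (hA'c x y).add (continuousOn_finsetSum _ fun c _ => ((hAc x c).mul (hb'c c)).mul (hAc c y))

end Riccati

end Summit.HubbardSuperconductivity.HubbardSuperconductivity.Theorems.KLRegimeSplit

end
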